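import Literature.Algebra.Homology.OrderedCechRestrict
import Mathlib.Algebra.Homology.HomologySequence
import Mathlib.RingTheory.Noetherian.Basic
import HarnessLib

/-!
# Unscrewing an ordered Čech complex along a subfamily: the piece supported on a sub-cover
# (Grothendieck's dévissage, EGA III 3.1.2 / Görtz–Wedhorn I Lemma 12.63, Čech bookkeeping)

Let `L' ≤ L : Finset ι → Submodule A 𝕂` be monotone families on a finite linearly ordered index set
(`Literature/Algebra/Homology/OrderedCech`: `L s = Γ(W_s, 𝓛) ⊆ K(Z)` for coherent subsheaves
`𝓛' ⊆ 𝓛` of the constant sheaf of rational functions on an integral scheme `Z` with a finite affine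
cover `(W_a)_{a ∈ ι}`). In the dévissage of the finiteness theorem for proper morphisms
(Görtz–Wedhorn II, Thm. 23.17 via Görtz–Wedhorn I, Lemma 12.63; EGA III 3.1.2–3.2.1) one meets
short exact sequences `0 → 𝓛' → 𝓛 → i_*𝓖 → 0` whose third term is a sheaf `𝓖 ⊆ K(Z₁)` on a SMALLER
integral closed subscheme `i : Z₁ ↪ Z`, seen through the members `(W_{e b} ∩ Z₁)_{b ∈ κ}` of the cover
that meet `Z₁` (`e : κ ↪o ι`); on the other members `𝓛' = 𝓛`. This file supplies the corresponding
short exact sequence of ordered Čech complexes and its consequences for finite generation of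
cohomology, in the generality of bare families:

* `OrderedCech.Cochain.mapFamily`, `OrderedCech.complexMapFamily` — the morphism of ordered Čech
  complexes `Č(F) → Č(G)` induced by MEMBERWISE linear maps `φ_s : F s → G s` compatible with the
  inclusions `F s ≤ F t`, `G s ≤ G t` (`s ⊆ t`) (`Literature/Algebra/Homology/OrderedCechMap` treats
  the special case of one ambient linear map `𝕂 → 𝕂'`; a quotient map `𝓛 → 𝓛/𝓛' ≅ i_*𝓖` is not of
  that form);
* `OrderedCech.pieceSC`, `OrderedCech.shortExact_pieceSC` — for `L' ≤ L` over `ι`, `G` over `κ`,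
  `e : κ ↪o ι`, memberwise surjections `ψ_s : L (e s) → G s` with kernels `L' (e s)`, compatible with
  inclusions, and `L s = L' s` for the simplices `s` outside the image of `e`:
  **`0 → Č(L') → Č(L) → Č_κ(G) → 0` is a short exact sequence of complexes** (inclusion, then
  restriction to the sub-family `Literature/Algebra/Homology/OrderedCechRestrict` followed by `ψ`);
* `OrderedCech.moduleFinite_homology_of_piece`, `OrderedCech.moduleFinite_homology_sub_of_piece` —
  over a Noetherian ring, finite generation of all `Hⁱ` passes from `(L', G)` to `L` and from `(L, G)`
  to `L'` (long exact sequence, Mathlib `ShortComplex.ShortExact.homology_exact₁/₂`);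
* `…NE` variants (`complexMapFamilyNE`, `pieceSCNE`, `shortExact_pieceSCNE`,
  `moduleFinite_homology_of_pieceNE`, `moduleFinite_homology_sub_of_pieceNE`) asking the
  compatibility / kernel / surjectivity hypotheses for NON-EMPTY index sets only (the values of the
  families at `∅` never enter the complexes).

Everything is elementary and proved; no named facts, no geometry. Mathlib searched (pin v4.32):
`HomologicalComplex.shortExact_of_degreewise_shortExact`, `ModuleCat.shortComplex_shortExact`,
`ShortComplex.ShortExact.homology_exact₁/₂`, `Submodule.fg_of_fg_map_of_fg_inf_ker` (used); Mathlib's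
`CategoryTheory/Sites/SheafCohomology/Cech` has no comparable API.

## References

* A. Grothendieck, EGA III₁ (Publ. Math. IHÉS 11, 1961), Thm. 3.1.2 (dévissage), Thm. 3.2.1.
* U. Görtz, T. Wedhorn, *Algebraic Geometry I: Schemes*, 2nd ed. (2020), Lemma 12.63 (PDF p. 436);
  *Algebraic Geometry II* (2023), Thm. 23.17 and its proof (PDF pp. 424–425), Def. 21.68 (p. 260).
  [GortzWedhorn2020] [GortzWedhorn2023]
* The Stacks Project, Tag 01YF (filtering coherent modules by pieces `i_*𝓘`, `𝓘 ⊆ 𝒪_{Z₁}`), Tag 01EV.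
-/

noncomputable section

universe u v

open CategoryTheory Finset

namespace Literature.Algebra.Homology

namespace OrderedCech

variable {ι κ : Type} [LinearOrder ι] [LinearOrder κ] {A : Type u} [CommRing A]
variable {𝕂 : Type v} [AddCommGroup 𝕂] [Module A 𝕂] {𝕃 : Type v} [AddCommGroup 𝕃] [Module A 𝕃]

/-! ### Middle terms of exact sequences over a Noetherian ring -/

/-- **The middle term of an exact sequence `M₁ → M₂ → M₃` of modules over a Noetherian ring with
finitely generated outer terms is finitely generated.** [folklore] -/
theorem moduleFinite_mid_of_exact [IsNoetherianRing A] (T : ShortComplex (ModuleCat.{v} A))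
    (hT : T.Exact) [Module.Finite A T.X₁] [Module.Finite A T.X₃] : Module.Finite A T.X₂ := by
  have hrange : LinearMap.range T.f.hom = LinearMap.ker T.g.hom := hT.moduleCat_range_eq_ker
  refine Module.Finite.of_fg_top (Submodule.fg_of_fg_map_of_fg_inf_ker T.g.hom ?_ ?_)
  · rw [Submodule.map_top]
    exact IsNoetherian.noetherian _
  · rw [top_inf_eq, ← hrange, LinearMap.range_eq_map]
    exact (Module.Finite.fg_top (R := A) (M := T.X₁)).map T.f.hom

/-! ### Morphisms of ordered Čech complexes from memberwise linear maps -/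

section FamilyHom

variable {F : Finset ι → Submodule A 𝕂} {G : Finset ι → Submodule A 𝕃}
variable (φ : ∀ s : Finset ι, F s →ₗ[A] G s)

/-- The map on cochains induced by memberwise linear maps `φ_s : F s → G s`:
`(φ g)_s = φ_s (g_s)`. [folklore] -/
def Cochain.mapFamily (n : ℤ) : Cochain F n →ₗ[A] Cochain G n where
  toFun g σ := φ σ.1 (g σ)
  map_add' g g' := by
    funext σ
    exact map_add (φ σ.1) (g σ) (g' σ)
  map_smul' a g := by
    funext σ
    exact map_smul (φ σ.1) a (g σ)

/-- The value of `mapFamily`. [folklore] -/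
@[simp] theorem Cochain.mapFamily_apply {n : ℤ} (g : Cochain F n) (σ : Simplex ι n) :
    Cochain.mapFamily φ n g σ = φ σ.1 (g σ) := rfl

/-- `mapFamily` and extension by zero. [folklore] -/
theorem Cochain.ext0_mapFamily {n : ℤ} (g : Cochain F n) (s : Finset ι) :
    (Cochain.mapFamily φ n g).ext0 s =
      if h : s.Nonempty ∧ (s.card : ℤ) = n + 1 then ((φ s (g ⟨s, h⟩) : G s) : 𝕃) else 0 := by
  unfold Cochain.ext0
  split_ifs <;> rfl

variable (hF : Monotone F) (hG : Monotone G)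
variable (hφ : ∀ ⦃s t : Finset ι⦄ (hst : s ⊆ t) (x : 𝕂) (hx : x ∈ F s),
    ((φ t ⟨x, hF hst hx⟩ : G t) : 𝕃) = (φ s ⟨x, hx⟩ : 𝕃))

omit hG hφ in
/-- The face map as an explicit `dite` (unfolding lemma). [folklore] -/
theorem faceMap_eq_dite (n : ℤ) (σ : Simplex ι (n + 1)) (a : ι) (g : Cochain F n) :
    faceMap F hF n σ a g =
      if h : (σ.1.erase a).Nonempty ∧ ((σ.1.erase a).card : ℤ) = n + 1 then
        sign A σ.1 a • Submodule.inclusion (hF (Finset.erase_subset a σ.1)) (g ⟨σ.1.erase a, h⟩)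
      else 0 := by
  unfold faceMap
  split_ifs <;> rfl

include hφ in
/-- **Memberwise maps compatible with the inclusions commute with the Čech differential.**
[folklore] -/
theorem d_mapFamily {n : ℤ} (g : Cochain F n) :
    d G hG n (Cochain.mapFamily φ n g) = Cochain.mapFamily φ (n + 1) (d F hF n g) := by
  funext σ
  apply Subtype.ext
  rw [coe_d_apply, Cochain.mapFamily_apply]
  have hd : d F hF n g σ = ∑ a ∈ σ.1, faceMap F hF n σ a g := by
    change (LinearMap.pi fun σ => ∑ a ∈ σ.1, faceMap F hF n σ a) g σ = _
    rw [LinearMap.pi_apply, LinearMap.sum_apply]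
  rw [hd, map_sum, Submodule.coe_sum]
  refine Finset.sum_congr rfl fun a _ => ?_
  rw [Cochain.ext0_mapFamily, faceMap_eq_dite]
  by_cases h : (σ.1.erase a).Nonempty ∧ ((σ.1.erase a).card : ℤ) = n + 1
  · rw [dif_pos h, dif_pos h, map_smul, Submodule.coe_smul]
    congr 1
    exact (hφ (Finset.erase_subset a σ.1) _ (g ⟨σ.1.erase a, h⟩).2).symm
  · rw [dif_neg h, dif_neg h, map_zero, Submodule.coe_zero, smul_zero]

/-- **The morphism of ordered Čech complexes** induced by compatible memberwise maps. [folklore] -/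
def complexMapFamily : complex F hF ⟶ complex G hG :=
  CochainComplex.ofHom (fun n => ModuleCat.ofHom (Cochain.mapFamily φ n)) fun n => by
    rw [complex_d, complex_d]
    ext g
    exact d_mapFamily φ hF hG hφ g

/-- The components of `complexMapFamily`. [folklore] -/
@[simp] theorem complexMapFamily_f (n : ℤ) :
    (complexMapFamily φ hF hG hφ).f n = ModuleCat.ofHom (Cochain.mapFamily φ n) := rfl

omit hG in
/-- `mapFamily` is surjective in each degree when all `φ_s` are. [folklore] -/
theorem Cochain.mapFamily_surjective {n : ℤ} (hsurj : ∀ s, Function.Surjective (φ s)) :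
    Function.Surjective (Cochain.mapFamily φ n) := by
  intro g
  choose x hx using fun σ : Simplex ι n => hsurj σ.1 (g σ)
  exact ⟨fun σ => x σ, funext fun σ => hx σ⟩

end FamilyHom

/-! ### The short exact sequence of a piece supported on a sub-cover -/

section Piece

variable (e : κ ↪o ι)
variable {L L' : Finset ι → Submodule A 𝕂} (hL : Monotone L) (hL' : Monotone L')
variable {G : Finset κ → Submodule A 𝕃} (hG : Monotone G)
variable (ψ : ∀ s : Finset κ, L (s.map e.toEmbedding) →ₗ[A] G s)

omit [LinearOrder ι] hL hL' in
/-- The inclusion `L' s ≤ L s` in the form consumed by `complexMap`. [folklore] -/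
theorem id_mem_of_le (hle : ∀ s, L' s ≤ L s) : ∀ s, ∀ x ∈ L' s, LinearMap.id (R := A) x ∈ L s :=
  fun s _ hx => hle s hx

/-- The compatibility of `ψ` with inclusions, for the restricted family `L ∘ e`. [folklore] -/
theorem compat_comapFamily
    (hψ : ∀ ⦃s t : Finset κ⦄ (hst : s ⊆ t) (x : 𝕂) (hx : x ∈ L (s.map e.toEmbedding)),
      ((ψ t ⟨x, hL (Finset.map_subset_map.2 hst) hx⟩ : G t) : 𝕃) = (ψ s ⟨x, hx⟩ : 𝕃)) :
    ∀ ⦃s t : Finset κ⦄ (hst : s ⊆ t) (x : 𝕂) (hx : x ∈ comapFamily e L s),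
      ((ψ t ⟨x, comapFamily_mono e hL hst hx⟩ : G t) : 𝕃) = (ψ s ⟨x, hx⟩ : 𝕃) :=
  fun _ _ hst x hx => hψ hst x hx

variable (hle : ∀ s, L' s ≤ L s)
variable (hψ : ∀ ⦃s t : Finset κ⦄ (hst : s ⊆ t) (x : 𝕂) (hx : x ∈ L (s.map e.toEmbedding)),
    ((ψ t ⟨x, hL (Finset.map_subset_map.2 hst) hx⟩ : G t) : 𝕃) = (ψ s ⟨x, hx⟩ : 𝕃))
variable (hker : ∀ (s : Finset κ) (x : L (s.map e.toEmbedding)),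
    ψ s x = 0 ↔ (x : 𝕂) ∈ L' (s.map e.toEmbedding))

/-- **The short complex `Č(L') → Č(L) → Č_κ(G)`**: inclusion, then restriction to the sub-family
`e` followed by the memberwise maps `ψ`. [folklore] -/
def pieceSC : ShortComplex (CochainComplex (ModuleCat.{v} A) ℤ) :=
  ShortComplex.mk (complexMap LinearMap.id (id_mem_of_le hle) hL' hL)
    (restrictMap e L hL ≫ complexMapFamily ψ (comapFamily_mono e hL) hG (compat_comapFamily e hL ψ hψ))
    (by
      ext n g
      change Cochain.mapFamily ψ n (Cochain.restrict e L n (Cochain.map LinearMap.id (id_mem_of_le hle) n g)) = 0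
      funext σ
      change ψ σ.1 _ = 0
      rw [hker]
      exact (g (Simplex.map e σ)).2)

/-- The first object of `pieceSC` is `Č(L')`. [folklore] -/
@[simp] theorem pieceSC_X₁ : (pieceSC e hL hL' hG ψ hle hψ hker).X₁ = complex L' hL' := rfl

/-- The second object of `pieceSC` is `Č(L)`. [folklore] -/
@[simp] theorem pieceSC_X₂ : (pieceSC e hL hL' hG ψ hle hψ hker).X₂ = complex L hL := rfl

/-- The third object of `pieceSC` is `Č_κ(G)`. [folklore] -/
@[simp] theorem pieceSC_X₃ : (pieceSC e hL hL' hG ψ hle hψ hker).X₃ = complex G hG := rfl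

variable (hsurj : ∀ s, Function.Surjective (ψ s))
variable (hout : ∀ s : Finset ι, s.Nonempty → (∀ t : Finset κ, t.map e.toEmbedding ≠ s) → L s ≤ L' s)

include hsurj hout in
/-- **`0 → Č(L') → Č(L) → Č_κ(G) → 0` is a short exact sequence of cochain complexes** when the
`ψ_s` are surjective with kernels `L' (e s)` and `L = L'` on the simplices outside the image of `e`
(the Čech form of `0 → 𝓛' → 𝓛 → i_*𝓖 → 0` for a sheaf `𝓖` on a closed subscheme meeting only the
members `W_{e b}` of the cover; cf. The Stacks Project, Tag 01EV). [folklore] -/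
theorem shortExact_pieceSC : (pieceSC e hL hL' hG ψ hle hψ hker).ShortExact := by
  classical
  apply HomologicalComplex.shortExact_of_degreewise_shortExact
  intro n
  apply ModuleCat.shortComplex_shortExact
  · -- exactness in the middle
    intro g
    constructor
    · intro hg
      change Cochain.mapFamily ψ n (Cochain.restrict e L n g) = 0 at hg
      have hmem : ∀ τ : Simplex ι n, (g τ : 𝕂) ∈ L' τ.1 := by
        intro τ
        by_cases h : ∃ t : Finset κ, t.map e.toEmbedding = τ.1
        · obtain ⟨t, ht⟩ := h
          have htne : t.Nonempty := Finset.map_nonempty.1 (ht ▸ τ.2.1)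
          have htcard : (t.card : ℤ) = n + 1 := by rw [← Finset.card_map e.toEmbedding, ht]; exact τ.2.2
          have hσ : Simplex.map e (⟨t, htne, htcard⟩ : Simplex κ n) = τ := Subtype.ext ht
          have := congr_arg (fun c : Cochain G n => c ⟨t, htne, htcard⟩) hg
          simp only [Cochain.mapFamily_apply, Cochain.restrict_apply] at this
          change ψ t (g (Simplex.map e ⟨t, htne, htcard⟩)) = 0 at this
          rw [hker] at this
          rw [← hσ]
          exact this
        · exact hout τ.1 τ.2.1 (fun t ht => h ⟨t, ht⟩) (g τ).2
      refine ⟨fun τ => ⟨(g τ : 𝕂), hmem τ⟩, ?_⟩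
      change Cochain.map LinearMap.id (id_mem_of_le hle) n _ = g
      funext τ
      rfl
    · rintro ⟨g', rfl⟩
      change Cochain.mapFamily ψ n (Cochain.restrict e L n (Cochain.map LinearMap.id (id_mem_of_le hle) n g')) = 0
      funext σ
      change ψ σ.1 _ = 0
      rw [hker]
      exact (g' (Simplex.map e σ)).2
  · exact Cochain.map_injective LinearMap.id (id_mem_of_le hle) fun _ _ _ h => h
  · change Function.Surjective (fun g => Cochain.mapFamily ψ n (Cochain.restrict e L n g))
    exact (Cochain.mapFamily_surjective ψ hsurj).comp
      (Cochain.restrict_surjective e L hL n)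

include hle hψ hker hsurj hout in
/-- **Finite generation ascends along a piece**: over a Noetherian ring, if all `Hⁱ(Č(L'))` and all
`Hⁱ(Č_κ(G))` are finitely generated, so are all `Hⁱ(Č(L))` (exactness of
`Hⁱ(Č(L')) → Hⁱ(Č(L)) → Hⁱ(Č_κ(G))`; Görtz–Wedhorn II, proof of Thm. 23.17, assertion (1)).
[cite: GortzWedhorn2023, Thm. 23.17, proof (PDF p. 424)] -/
theorem moduleFinite_homology_of_piece [IsNoetherianRing A]
    (h' : ∀ i, Module.Finite A ((complex L' hL').homology i))
    (hGf : ∀ i, Module.Finite A ((complex G hG).homology i)) (i : ℤ) :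
    Module.Finite A ((complex L hL).homology i) := by
  have hS := shortExact_pieceSC e hL hL' hG ψ hle hψ hker hsurj hout
  have hex := hS.homology_exact₂ i
  haveI : Module.Finite A ((pieceSC e hL hL' hG ψ hle hψ hker).X₁.homology i) := h' i
  haveI : Module.Finite A ((pieceSC e hL hL' hG ψ hle hψ hker).X₃.homology i) := hGf i
  exact moduleFinite_mid_of_exact _ hex

include hle hψ hker hsurj hout in
/-- **Finite generation descends along a piece**: over a Noetherian ring, if all `Hⁱ(Č(L))` and all
`Hⁱ(Č_κ(G))` are finitely generated, so are all `Hⁱ(Č(L'))` (exactness of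
`Hⁱ⁻¹(Č_κ(G)) → Hⁱ(Č(L')) → Hⁱ(Č(L))`). [cite: GortzWedhorn2023, Thm. 23.17, proof (PDF p. 424)] -/
theorem moduleFinite_homology_sub_of_piece [IsNoetherianRing A]
    (h : ∀ i, Module.Finite A ((complex L hL).homology i))
    (hGf : ∀ i, Module.Finite A ((complex G hG).homology i)) (i : ℤ) :
    Module.Finite A ((complex L' hL').homology i) := by
  have hS := shortExact_pieceSC e hL hL' hG ψ hle hψ hker hsurj hout
  have hex := hS.homology_exact₁ (i - 1) i (by simp)
  haveI : Module.Finite A ((pieceSC e hL hL' hG ψ hle hψ hker).X₃.homology (i - 1)) := hGf (i - 1)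
  haveI : Module.Finite A ((pieceSC e hL hL' hG ψ hle hψ hker).X₂.homology i) := h i
  exact moduleFinite_mid_of_exact _ hex

end Piece

/-! ### Variants with hypotheses on non-empty index sets only

The Čech complexes only involve the simplices, i.e. NON-EMPTY finite sets of indices; the values of
the families at `∅` (global sections, on which nothing algebraic is imposed) never enter. The
following variants of `complexMapFamily` and `pieceSC` ask the compatibility, kernel and
surjectivity hypotheses for non-empty `s` only. -/

section NonemptyVariants

section FamilyHomNE

variable {F : Finset ι → Submodule A 𝕂} {G : Finset ι → Submodule A 𝕃}
variable (φ : ∀ s : Finset ι, F s →ₗ[A] G s) (hF : Monotone F) (hG : Monotone G)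
variable (hφ : ∀ ⦃s t : Finset ι⦄, s.Nonempty → ∀ (hst : s ⊆ t) (x : 𝕂) (hx : x ∈ F s),
    ((φ t ⟨x, hF hst hx⟩ : G t) : 𝕃) = (φ s ⟨x, hx⟩ : 𝕃))

include hφ in
/-- `d_mapFamily` with the compatibility asked for non-empty `s` only. [folklore] -/
theorem d_mapFamily_of_nonempty {n : ℤ} (g : Cochain F n) :
    d G hG n (Cochain.mapFamily φ n g) = Cochain.mapFamily φ (n + 1) (d F hF n g) := by
  funext σ
  apply Subtype.ext
  rw [coe_d_apply, Cochain.mapFamily_apply]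
  have hd : d F hF n g σ = ∑ a ∈ σ.1, faceMap F hF n σ a g := by
    change (LinearMap.pi fun σ => ∑ a ∈ σ.1, faceMap F hF n σ a) g σ = _
    rw [LinearMap.pi_apply, LinearMap.sum_apply]
  rw [hd, map_sum, Submodule.coe_sum]
  refine Finset.sum_congr rfl fun a _ => ?_
  rw [Cochain.ext0_mapFamily, faceMap_eq_dite]
  by_cases h : (σ.1.erase a).Nonempty ∧ ((σ.1.erase a).card : ℤ) = n + 1
  · rw [dif_pos h, dif_pos h, map_smul, Submodule.coe_smul]
    congr 1
    exact (hφ h.1 (Finset.erase_subset a σ.1) _ (g ⟨σ.1.erase a, h⟩).2).symm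
  · rw [dif_neg h, dif_neg h, map_zero, Submodule.coe_zero, smul_zero]

/-- `complexMapFamily` with the compatibility asked for non-empty `s` only. [folklore] -/
def complexMapFamilyNE : complex F hF ⟶ complex G hG :=
  CochainComplex.ofHom (fun n => ModuleCat.ofHom (Cochain.mapFamily φ n)) fun n => by
    rw [complex_d, complex_d]
    ext g
    exact d_mapFamily_of_nonempty φ hF hG hφ g

/-- The components of `complexMapFamilyNE`. [folklore] -/
@[simp] theorem complexMapFamilyNE_f (n : ℤ) :
    (complexMapFamilyNE φ hF hG hφ).f n = ModuleCat.ofHom (Cochain.mapFamily φ n) := rfl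

omit hG in
/-- `mapFamily` is surjective in each degree when the `φ_s`, `s ≠ ∅`, are. [folklore] -/
theorem Cochain.mapFamily_surjective_of_nonempty {n : ℤ}
    (hsurj : ∀ s, s.Nonempty → Function.Surjective (φ s)) :
    Function.Surjective (Cochain.mapFamily φ n) := by
  intro g
  choose x hx using fun σ : Simplex ι n => hsurj σ.1 σ.2.1 (g σ)
  exact ⟨fun σ => x σ, funext fun σ => hx σ⟩

end FamilyHomNE

section PieceNE

variable (e : κ ↪o ι)
variable {L L' : Finset ι → Submodule A 𝕂} (hL : Monotone L) (hL' : Monotone L')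
variable {G : Finset κ → Submodule A 𝕃} (hG : Monotone G)
variable (ψ : ∀ s : Finset κ, L (s.map e.toEmbedding) →ₗ[A] G s)

/-- The compatibility of `ψ` with inclusions (non-empty `s`), for the restricted family `L ∘ e`.
[folklore] -/
theorem compat_comapFamily_of_nonempty
    (hψ : ∀ ⦃s t : Finset κ⦄, s.Nonempty → ∀ (hst : s ⊆ t) (x : 𝕂)
      (hx : x ∈ L (s.map e.toEmbedding)),
      ((ψ t ⟨x, hL (Finset.map_subset_map.2 hst) hx⟩ : G t) : 𝕃) = (ψ s ⟨x, hx⟩ : 𝕃)) :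
    ∀ ⦃s t : Finset κ⦄, s.Nonempty → ∀ (hst : s ⊆ t) (x : 𝕂) (hx : x ∈ comapFamily e L s),
      ((ψ t ⟨x, comapFamily_mono e hL hst hx⟩ : G t) : 𝕃) = (ψ s ⟨x, hx⟩ : 𝕃) :=
  fun _ _ hs hst x hx => hψ hs hst x hx

variable (hle : ∀ s, L' s ≤ L s)
variable (hψ : ∀ ⦃s t : Finset κ⦄, s.Nonempty → ∀ (hst : s ⊆ t) (x : 𝕂)
    (hx : x ∈ L (s.map e.toEmbedding)),
    ((ψ t ⟨x, hL (Finset.map_subset_map.2 hst) hx⟩ : G t) : 𝕃) = (ψ s ⟨x, hx⟩ : 𝕃))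
variable (hker : ∀ (s : Finset κ), s.Nonempty → ∀ x : L (s.map e.toEmbedding),
    ψ s x = 0 ↔ (x : 𝕂) ∈ L' (s.map e.toEmbedding))

/-- **The short complex `Č(L') → Č(L) → Č_κ(G)`** (`pieceSC` with hypotheses on non-empty `s`
only). [folklore] -/
def pieceSCNE : ShortComplex (CochainComplex (ModuleCat.{v} A) ℤ) :=
  ShortComplex.mk (complexMap LinearMap.id (id_mem_of_le hle) hL' hL)
    (restrictMap e L hL ≫
      complexMapFamilyNE ψ (comapFamily_mono e hL) hG (compat_comapFamily_of_nonempty e hL ψ hψ))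
    (by
      ext n g
      change Cochain.mapFamily ψ n (Cochain.restrict e L n
        (Cochain.map LinearMap.id (id_mem_of_le hle) n g)) = 0
      funext σ
      change ψ σ.1 _ = 0
      rw [hker σ.1 σ.2.1]
      exact (g (Simplex.map e σ)).2)

/-- The first object of `pieceSCNE` is `Č(L')`. [folklore] -/
@[simp] theorem pieceSCNE_X₁ : (pieceSCNE e hL hL' hG ψ hle hψ hker).X₁ = complex L' hL' := rfl

/-- The second object of `pieceSCNE` is `Č(L)`. [folklore] -/
@[simp] theorem pieceSCNE_X₂ : (pieceSCNE e hL hL' hG ψ hle hψ hker).X₂ = complex L hL := rfl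

/-- The third object of `pieceSCNE` is `Č_κ(G)`. [folklore] -/
@[simp] theorem pieceSCNE_X₃ : (pieceSCNE e hL hL' hG ψ hle hψ hker).X₃ = complex G hG := rfl

variable (hsurj : ∀ s, s.Nonempty → Function.Surjective (ψ s))
variable (hout : ∀ s : Finset ι, s.Nonempty → (∀ t : Finset κ, t.map e.toEmbedding ≠ s) → L s ≤ L' s)

include hsurj hout in
/-- **`0 → Č(L') → Č(L) → Č_κ(G) → 0` is short exact** (`shortExact_pieceSC` with hypotheses on
non-empty `s` only). [folklore] -/
theorem shortExact_pieceSCNE : (pieceSCNE e hL hL' hG ψ hle hψ hker).ShortExact := by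
  classical
  apply HomologicalComplex.shortExact_of_degreewise_shortExact
  intro n
  apply ModuleCat.shortComplex_shortExact
  · intro g
    constructor
    · intro hg
      change Cochain.mapFamily ψ n (Cochain.restrict e L n g) = 0 at hg
      have hmem : ∀ τ : Simplex ι n, (g τ : 𝕂) ∈ L' τ.1 := by
        intro τ
        by_cases h : ∃ t : Finset κ, t.map e.toEmbedding = τ.1
        · obtain ⟨t, ht⟩ := h
          have htne : t.Nonempty := Finset.map_nonempty.1 (ht ▸ τ.2.1)
          have htcard : (t.card : ℤ) = n + 1 := by
            rw [← Finset.card_map e.toEmbedding, ht]; exact τ.2.2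
          have hσ : Simplex.map e (⟨t, htne, htcard⟩ : Simplex κ n) = τ := Subtype.ext ht
          have := congr_arg (fun c : Cochain G n => c ⟨t, htne, htcard⟩) hg
          simp only [Cochain.mapFamily_apply, Cochain.restrict_apply] at this
          change ψ t (g (Simplex.map e ⟨t, htne, htcard⟩)) = 0 at this
          rw [hker t htne] at this
          rw [← hσ]
          exact this
        · exact hout τ.1 τ.2.1 (fun t ht => h ⟨t, ht⟩) (g τ).2
      refine ⟨fun τ => ⟨(g τ : 𝕂), hmem τ⟩, ?_⟩
      change Cochain.map LinearMap.id (id_mem_of_le hle) n _ = g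
      funext τ
      rfl
    · rintro ⟨g', rfl⟩
      change Cochain.mapFamily ψ n (Cochain.restrict e L n
        (Cochain.map LinearMap.id (id_mem_of_le hle) n g')) = 0
      funext σ
      change ψ σ.1 _ = 0
      rw [hker σ.1 σ.2.1]
      exact (g' (Simplex.map e σ)).2
  · exact Cochain.map_injective LinearMap.id (id_mem_of_le hle) fun _ _ _ h => h
  · change Function.Surjective (fun g => Cochain.mapFamily ψ n (Cochain.restrict e L n g))
    exact (Cochain.mapFamily_surjective_of_nonempty ψ hsurj).comp
      (Cochain.restrict_surjective e L hL n)

include hle hψ hker hsurj hout in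
/-- **Finite generation ascends along a piece** (`moduleFinite_homology_of_piece` with hypotheses
on non-empty `s` only). [cite: GortzWedhorn2023, Thm. 23.17, proof (PDF p. 424)] -/
theorem moduleFinite_homology_of_pieceNE [IsNoetherianRing A]
    (h' : ∀ i, Module.Finite A ((complex L' hL').homology i))
    (hGf : ∀ i, Module.Finite A ((complex G hG).homology i)) (i : ℤ) :
    Module.Finite A ((complex L hL).homology i) := by
  have hS := shortExact_pieceSCNE e hL hL' hG ψ hle hψ hker hsurj hout
  have hex := hS.homology_exact₂ i
  haveI : Module.Finite A ((pieceSCNE e hL hL' hG ψ hle hψ hker).X₁.homology i) := h' i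
  haveI : Module.Finite A ((pieceSCNE e hL hL' hG ψ hle hψ hker).X₃.homology i) := hGf i
  exact moduleFinite_mid_of_exact _ hex

include hle hψ hker hsurj hout in
/-- **Finite generation descends along a piece** (`moduleFinite_homology_sub_of_piece` with
hypotheses on non-empty `s` only). [cite: GortzWedhorn2023, Thm. 23.17, proof (PDF p. 424)] -/
theorem moduleFinite_homology_sub_of_pieceNE [IsNoetherianRing A]
    (h : ∀ i, Module.Finite A ((complex L hL).homology i))
    (hGf : ∀ i, Module.Finite A ((complex G hG).homology i)) (i : ℤ) :
    Module.Finite A ((complex L' hL').homology i) := by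
  have hS := shortExact_pieceSCNE e hL hL' hG ψ hle hψ hker hsurj hout
  have hex := hS.homology_exact₁ (i - 1) i (by simp)
  haveI : Module.Finite A ((pieceSCNE e hL hL' hG ψ hle hψ hker).X₃.homology (i - 1)) := hGf (i - 1)
  haveI : Module.Finite A ((pieceSCNE e hL hL' hG ψ hle hψ hker).X₂.homology i) := h i
  exact moduleFinite_mid_of_exact _ hex

end PieceNE

end NonemptyVariants

end OrderedCech

end Literature.Algebra.Homology
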